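import Summits.CriticalPhenomena.PercolationContinuityZ3.Theorems.PercNearOneGluingNoHeavyQuantLightPairAdmissible
import Summits.CriticalPhenomena.PercolationContinuityZ3.Theorems.PercNearOneGluingNoHeavyQuantSGCLightCellsNoLow
import HarnessLib

/-!
# QUANT lane R8, T-DEC, ROUTE 2 (`AD3ProdCell` / `AD3GateCell`): PAIR PLANS — a mixture of mean-`T` pairs each of which is heavy or has a
# self-sufficient low atom is an AD3⁺ decomposition; hence every top-affordable law WITHOUT LOW ATOMS is AD3⁺ (Lemma P), and
# `AD3ProdCell` holds whenever the product has no atom `a < T` with `2a < q·T`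

builds on p205010 (kernel theorem, internal audit signed; external expert review pending)

Support file (`--supports stmt-CriticalPhenomena-4575`), QUANT lane, seat prim-quant-arm-3 (gen 121; CLAIM `AD3ProdCell` H⊗L2, lead g34 ruling
V342), rung R8 of `run/shared/lean/prim/quant/LADDER.md`.  Theorems only, standard axioms, no sorries, no definitions.  Uses
`isAD3Component_pair_of_two_lo_ge` (`…QuantLightPairAdmissible`: a top-affordable pair with `q·T ≤ 2·lo` is an AD3⁺ component — H or L2
with its DEC obligation discharged by the moment criterion) and typer g31's `ad3Decomp_iff`, `isAD3Component_laws`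
(`…QuantTreeBuiltAD3Cells`), Lemma P `exists_twoPoint_decomposition_TA` (lead g14).

* `LawDec.isAD3Component_pointTP` — a sure point at `T` is an AD3⁺ component (`y ≤ q`).
* **`LawDec.ad3Decomp_of_pairPlan`** — `μ = Σ_r λ_r·{lo_r, hi_r; g_r}` (finite, `λ ≥ 0`, `Σ λ = 1`), every charged pair of mean `T` with
  `lo_r ≤ hi_r ≤ M` and [heavy `y ≤ q·g_r`, or a point, or `q·T ≤ 2·lo_r`], `y·M ≤ q·T`, `0 < y < 1`, `0 < q ≤ 1`, `y ≤ q` ⟹ `AD3Decomp y q T M μ`.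
  (Route 2's transport plans, lead g34 FOR-PROVERS-AD3PROD-HH §2/§5: a plan needs to be HEAVY only on the pairs whose low end is a genuine low.)
* **`LawDec.ad3Decomp_of_noLow`** — a law on `{0..M}` (mass 1, mean `T`, `y·M ≤ q·T`) whose charged atoms `a < T` all have `q·T ≤ 2a` is
  AD3⁺ at `(y, q, T, M)`: Lemma P's canonical pairs have charged low ends.
* **`LawDec.ad3ProdCell_of_noLow`** — `AD3ProdCell`'s conclusion for two components `ω₁`, `ω₂` whenever every charged atom `a < T₁ + T₂` of
  `ω₁ ∗ ω₂` has `q(T₁+T₂) ≤ 2a`; **`LawDec.ad3ProdCell_of_minAtoms`** — in particular whenever the least charged atoms `m₁`, `m₂` satisfy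
  `q(T₁+T₂) ≤ 2(m₁+m₂)`.  EXACT CENSUS (arm-3 g121 `explore/hl2_census.py`, `hh_pairs.py`): this is 112 289 / 116 886 sampled H⊗L2
  instances (96 %) and 73 102 / 82 002 H⊗H instances; of the rest, pair plans heavy-or-self-sufficient exist in all but 378 (H⊗L2) resp.
  56 (H⊗H) instances, which need a triple component (and have one: 0 non-AD3⁺).
* **`LawDec.ad3Decomp_of_lows_heavyTop`** / **`LawDec.ad3ProdCell_of_lows_heavyTop`** — if every genuine low `a` (`2a < q·T`) pairs
  HEAVILY with the top charged atom (`y(top − a) ≤ q(T − a)`; heaviness is antitone in the partner, so this is the largest-low test of lead g34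
  §2), every Lemma-P plan is AD3⁺.  H⊗L2 census: 20 912 of the 22 760 low-carrying instances; what remains of H⊗L2 is pair transport into
  lower partners (59) and a TRIPLE sub-cell (1 789 = 7.9 % of the low-carrying, 1.5 % of all instances).
* `LawDec.tp_atom_cases`; **`LawDec.ad3ProdCell_HL2_of_residual`** — the kind pair H⊗L2 of `AD3ProdCell` from its RESIDUAL sub-cell (a
  genuine low whose top pair is light: 1 848 / 22 760 low-carrying instances, the pair-transport (59) and triple (1 789) cases).
HONEST STATUS: `AD3ProdCell` (the low-atom transport sub-cells and the triple residual), `AD3GateCell`, `TreeBuiltAD3`, CW, SGC,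
`FarTreeRow` remain OPEN; nothing here is a published result; RATE class log\* / honest sentence unchanged.

[this work]; AD3⁺ cells and bookkeeping: prim-quant-stmt g31; H⊗H structure: prim-quant-lead g34; Lemma P: prim-quant-lead g14 (this lane).
The gluing rows served [cite: KozmaNitzan2024, Conjecture 3 (p. 15)]; product measure [cite: Grimmett1999, §1.3 p. 10].
-/

noncomputable section

namespace Summit.CriticalPhenomena.PercolationContinuityZ3.Theorems

namespace Quant

open Finset

/-- two-point law notation `TP[lo, hi, g, h] = g·[h = hi] + (1 − g)·[h = lo]` (as in the lane's other files). -/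
local notation3 "TP[" lo ", " hi ", " g ", " h "]" =>
  (g : ℝ) * (if (h : ℕ) = (hi : ℕ) then (1 : ℝ) else 0) + (1 - (g : ℝ)) * (if (h : ℕ) = (lo : ℕ) then (1 : ℝ) else 0)

namespace LawDec

/-! ### Pair plans -/

/-- a sure point `k = T` (`k ≤ M`, `y ≤ q`) is an AD3⁺ component, written as the degenerate heavy pair `{k, k; 1}`. [this work] -/
theorem isAD3Component_pointTP (y q : ℝ) (M k : ℕ) (hkM : k ≤ M) (hyq : y ≤ q) :
    IsAD3Component y q (k : ℝ) M (fun h => TP[k, k, (1 : ℝ), h]) :=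
  Or.inl ⟨k, k, 1, le_rfl, hkM, zero_le_one, le_rfl, by rw [mul_one]; exact hyq, by ring, rfl⟩

/-- a degenerate pair is the sure point whatever its gate: `{k, k; g} = {k, k; 1}`. [folklore] -/
theorem TP_point_eq (k : ℕ) (g : ℝ) (h : ℕ) : TP[k, k, g, h] = TP[k, k, (1 : ℝ), h] := by ring

/-- **A PAIR PLAN THAT IS HEAVY ON ITS GENUINE LOWS IS AN AD3⁺ DECOMPOSITION.**  `μ = Σ_r λ_r·{lo_r, hi_r; g_r}` with, for every charged `r`,
`lo_r ≤ hi_r ≤ M`, `0 ≤ g_r ≤ 1`, mean `lo_r + (hi_r − lo_r)g_r = T`, and `y ≤ q·g_r` (heavy) or `lo_r = hi_r` (a point) or `q·T ≤ 2·lo_r`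
(self-sufficient low end); floor/gate `0 < y < 1`, `0 < q ≤ 1`, `y ≤ q`; `y·M ≤ q·T`.  Then `AD3Decomp y q T M μ`. [this work] -/
theorem ad3Decomp_of_pairPlan {ρ : Type} [Fintype ρ] (y q T : ℝ) (M : ℕ) (μ : ℕ → ℝ) (lam g : ρ → ℝ) (lo hi : ρ → ℕ)
    (hy0 : 0 < y) (hy1 : y < 1) (hq0 : 0 < q) (hq1 : q ≤ 1) (hyq : y ≤ q) (hta : y * (M : ℝ) ≤ q * T)
    (h0 : ∀ r, 0 ≤ lam r) (h1 : ∑ r, lam r = 1) (hμ : ∀ h, μ h = ∑ r, lam r * TP[lo r, hi r, g r, h])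
    (hpair : ∀ r, 0 < lam r → lo r ≤ hi r ∧ hi r ≤ M ∧ 0 ≤ g r ∧ g r ≤ 1 ∧ (lo r : ℝ) + ((hi r : ℝ) - lo r) * g r = T ∧
      (y ≤ q * g r ∨ lo r = hi r ∨ q * T ≤ 2 * (lo r : ℝ))) :
    AD3Decomp y q T M μ := by
  classical
  -- normalise degenerate pairs to gate 1 so that they are literally heavy components
  set ω : ρ → ℕ → ℝ := fun r h => if lo r = hi r then TP[lo r, lo r, (1 : ℝ), h] else TP[lo r, hi r, g r, h] with hω
  have hωeq : ∀ r h, lam r * TP[lo r, hi r, g r, h] = lam r * ω r h := by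
    intro r h
    by_cases he : lo r = hi r
    · have e : ω r h = TP[lo r, lo r, (1 : ℝ), h] := by simp only [hω, if_pos he]
      rw [e, ← he, TP_point_eq (lo r) (g r) h]
    · have e : ω r h = TP[lo r, hi r, g r, h] := by simp only [hω, if_neg he]
      rw [e]
  refine (ad3Decomp_iff y q T M μ).2 ⟨ρ, inferInstance, lam, ω, h0, h1, fun h => ?_, fun r hr => ?_⟩
  · rw [hμ h]; exact Finset.sum_congr rfl fun r _ => hωeq r h
  · obtain ⟨hlohi, hhi, hg0, hg1, hmean, hkind⟩ := hpair r hr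
    by_cases he : lo r = hi r
    · -- a point at `T`
      have hT : (lo r : ℝ) = T := by rw [← hmean, ← he, sub_self, zero_mul, add_zero]
      have e : ω r = fun h => TP[lo r, lo r, (1 : ℝ), h] := by funext h; simp only [hω, if_pos he]
      rw [e, ← hT]
      exact isAD3Component_pointTP y q M (lo r) (hlohi.trans hhi) hyq
    · have e : ω r = fun h => TP[lo r, hi r, g r, h] := by funext h; simp only [hω, if_neg he]
      rw [e]
      have hlt : lo r < hi r := lt_of_le_of_ne hlohi he
      rcases hkind with hheavy | hpt | h2lo
      · exact Or.inl ⟨lo r, hi r, g r, hlohi, hhi, hg0, hg1, hheavy, hmean, rfl⟩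
      · exact absurd hpt he
      · rw [← hmean] at hta h2lo ⊢
        exact isAD3Component_pair_of_two_lo_ge y q (g r) M (lo r) (hi r) hy0 hy1 hq0 hq1 hlt hhi hg0 hg1 hta h2lo

/-! ### Laws without low atoms are AD3⁺ -/

/-- **A TOP-AFFORDABLE LAW WITHOUT LOW ATOMS IS AD3⁺.**  `μ ≥ 0` on `{0..M}`, mass `1`, mean `T`, `y·M ≤ q·T` (`0 < y < 1`, `0 < q ≤ 1`,
`y ≤ q`); if every charged atom `a` with `a < T` has `q·T ≤ 2a`, then `AD3Decomp y q T M μ`: Lemma P's canonical pairs have charged ends,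
the low end below `T` (or the pair is a point at `T`), so the plan of `ad3Decomp_of_pairPlan` applies. [this work] -/
theorem ad3Decomp_of_noLow (y q T : ℝ) (M : ℕ) (μ : ℕ → ℝ) (hy0 : 0 < y) (hy1 : y < 1) (hq0 : 0 < q) (hq1 : q ≤ 1) (hyq : y ≤ q)
    (hμ0 : ∀ h, 0 ≤ μ h) (hμM : ∀ h, M < h → μ h = 0) (hμ1 : ∑ h ∈ Finset.range (M + 1), μ h = 1)
    (hT : ∑ h ∈ Finset.range (M + 1), (h : ℝ) * μ h = T) (hta : y * (M : ℝ) ≤ q * T)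
    (hnolow : ∀ a, 0 < μ a → (a : ℝ) < T → q * T ≤ 2 * (a : ℝ)) :
    AD3Decomp y q T M μ := by
  -- Lemma P at floor `y`: every charged atom is affordable (`y·h ≤ y·M ≤ q·T ≤ T`)
  have hTnn : 0 ≤ T := by
    rw [← hT]; exact Finset.sum_nonneg fun h _ => mul_nonneg (Nat.cast_nonneg h) (hμ0 h)
  have htop : ∀ h, 0 < μ h → y * (h : ℝ) ≤ ∑ k ∈ Finset.range (M + 1), (k : ℝ) * μ k := by
    intro h hh
    have hhM : h ≤ M := by
      by_contra hc; exact absurd (hμM h (by omega)) hh.ne'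
    have h1 : y * (h : ℝ) ≤ y * (M : ℝ) := mul_le_mul_of_nonneg_left (by exact_mod_cast hhM) hy0.le
    rw [hT]; nlinarith
  obtain ⟨lam, g, lo, hi, h0, h1, hg, hlohi, hhi, hμ, hgen⟩ :=
    exists_twoPoint_decomposition_TA M M le_rfl μ hμ0 hμM hμ1 y htop
  refine ad3Decomp_of_pairPlan y q T M μ lam g lo hi hy0 hy1 hq0 hq1 hyq hta h0 h1 hμ fun r hr => ?_
  obtain ⟨hclo, -, hmean, hstrict, -⟩ := hgen r hr
  rw [hT] at hmean hstrict
  refine ⟨hlohi r, hhi r, (hg r).1, (hg r).2, hmean, ?_⟩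
  rcases Nat.eq_or_lt_of_le (hlohi r) with he | hlt
  · exact Or.inr (Or.inl he)
  · exact Or.inr (Or.inr (hnolow (lo r) hclo (hstrict hlt).1))

/-! ### `AD3ProdCell` without low atoms -/

/-- **`AD3ProdCell` WHEN THE PRODUCT HAS NO LOW ATOM.**  Components `ω₁`, `ω₂` at `(y, q, Tᵢ, Mᵢ)` (`0 < y < q ≤ 1`, `y·Mᵢ ≤ q·Tᵢ`); if every
charged atom `a < T₁ + T₂` of `ω₁ ∗ ω₂` has `q(T₁ + T₂) ≤ 2a`, then `AD3Decomp y q (T₁+T₂) (M₁+M₂) (ω₁ ∗ ω₂)`. [this work] -/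
theorem ad3ProdCell_of_noLow (y q T₁ T₂ : ℝ) (M₁ M₂ : ℕ) (ω₁ ω₂ : ℕ → ℝ)
    (hy0 : 0 < y) (hyq : y < q) (hq1 : q ≤ 1) (hta₁ : y * (M₁ : ℝ) ≤ q * T₁) (hta₂ : y * (M₂ : ℝ) ≤ q * T₂)
    (h₁ : IsAD3Component y q T₁ M₁ ω₁) (h₂ : IsAD3Component y q T₂ M₂ ω₂)
    (hnolow : ∀ a, 0 < lconv M₁ M₂ ω₁ ω₂ a → (a : ℝ) < T₁ + T₂ → q * (T₁ + T₂) ≤ 2 * (a : ℝ)) :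
    AD3Decomp y q (T₁ + T₂) (M₁ + M₂) (lconv M₁ M₂ ω₁ ω₂) := by
  obtain ⟨a0, aM, a1, amean⟩ := isAD3Component_laws h₁
  obtain ⟨b0, bM, b1, bmean⟩ := isAD3Component_laws h₂
  have hq0 : 0 < q := hy0.trans hyq
  have hy1 : y < 1 := lt_of_lt_of_le hyq hq1
  refine ad3Decomp_of_noLow y q (T₁ + T₂) (M₁ + M₂) _ hy0 hy1 hq0 hq1 hyq.le (lconv_nonneg M₁ M₂ ω₁ ω₂ a0 b0)
    (fun k hk => lconv_eq_zero M₁ M₂ ω₁ ω₂ k hk) (sum_lconv M₁ M₂ ω₁ ω₂ a1 b1) ?_ ?_ hnolow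
  · rw [sum_mul_lconv M₁ M₂ ω₁ ω₂ a1 b1, amean, bmean]
  · push_cast; rw [mul_add, mul_add]; exact add_le_add hta₁ hta₂

/-- **`AD3ProdCell` BY LEAST ATOMS**: if the least charged atoms `m₁` of `ω₁` and `m₂` of `ω₂` satisfy `q(T₁+T₂) ≤ 2(m₁+m₂)` the product has
no low atom (`exists_of_lconv_pos`) and `ad3ProdCell_of_noLow` applies.  (H⊗L2: `m₁ = lo₁`, `m₂ = lo₂`; EXACT CENSUS: 96 % of sampled
H⊗L2 instances, module docstring.) [this work] -/
theorem ad3ProdCell_of_minAtoms (y q T₁ T₂ : ℝ) (M₁ M₂ m₁ m₂ : ℕ) (ω₁ ω₂ : ℕ → ℝ)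
    (hy0 : 0 < y) (hyq : y < q) (hq1 : q ≤ 1) (hta₁ : y * (M₁ : ℝ) ≤ q * T₁) (hta₂ : y * (M₂ : ℝ) ≤ q * T₂)
    (h₁ : IsAD3Component y q T₁ M₁ ω₁) (h₂ : IsAD3Component y q T₂ M₂ ω₂)
    (hm₁ : ∀ i, 0 < ω₁ i → m₁ ≤ i) (hm₂ : ∀ k, 0 < ω₂ k → m₂ ≤ k)
    (hmin : q * (T₁ + T₂) ≤ 2 * ((m₁ : ℝ) + m₂)) :
    AD3Decomp y q (T₁ + T₂) (M₁ + M₂) (lconv M₁ M₂ ω₁ ω₂) := by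
  obtain ⟨a0, -, -, -⟩ := isAD3Component_laws h₁
  obtain ⟨b0, -, -, -⟩ := isAD3Component_laws h₂
  refine ad3ProdCell_of_noLow y q T₁ T₂ M₁ M₂ ω₁ ω₂ hy0 hyq hq1 hta₁ hta₂ h₁ h₂ fun a ha _ => ?_
  obtain ⟨i, k, hik, hi, hk⟩ := exists_of_lconv_pos M₁ M₂ ω₁ ω₂ a0 b0 a ha
  have e1 := hm₁ i hi
  have e2 := hm₂ k hk
  have : ((m₁ : ℝ) + m₂) ≤ a := by exact_mod_cast (show m₁ + m₂ ≤ a by omega)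
  linarith

/-! ### Lows that pair heavily with the top atom -/

/-- **IF EVERY GENUINE LOW PAIRS HEAVILY WITH THE TOP ATOM, ANY LEMMA-P PLAN IS AD3⁺.**  `μ ≥ 0` on `{0..M}`, mass `1`, mean `T`,
`y·M ≤ q·T`; `top` bounds the charged atoms; if every charged `a < T` with `2a < q·T` satisfies `y·(top − a) ≤ q·(T − a)` (the pair
`{a, top}` of mean `T` is heavy — and then so is every mean-`T` pair `{a, h}`, `h ≤ top`, since heaviness is antitone in the partner), then
`AD3Decomp y q T M μ`.  (Lead g34's nested-compatibility remark, FOR-PROVERS-AD3PROD-HH §2: it suffices to test the LARGEST low.) [this work] -/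
theorem ad3Decomp_of_lows_heavyTop (y q T : ℝ) (M top : ℕ) (μ : ℕ → ℝ) (hy0 : 0 < y) (hy1 : y < 1) (hq0 : 0 < q) (hq1 : q ≤ 1)
    (hyq : y ≤ q) (hμ0 : ∀ h, 0 ≤ μ h) (hμM : ∀ h, M < h → μ h = 0) (hμ1 : ∑ h ∈ Finset.range (M + 1), μ h = 1)
    (hT : ∑ h ∈ Finset.range (M + 1), (h : ℝ) * μ h = T) (hta : y * (M : ℝ) ≤ q * T)
    (htop : ∀ h, 0 < μ h → h ≤ top)
    (hheavy : ∀ a, 0 < μ a → (a : ℝ) < T → 2 * (a : ℝ) < q * T → y * ((top : ℝ) - a) ≤ q * (T - a)) :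
    AD3Decomp y q T M μ := by
  have htop' : ∀ h, 0 < μ h → y * (h : ℝ) ≤ ∑ k ∈ Finset.range (M + 1), (k : ℝ) * μ k := by
    intro h hh
    have hhM : h ≤ M := by
      by_contra hc; exact absurd (hμM h (by omega)) hh.ne'
    have h1 : y * (h : ℝ) ≤ y * (M : ℝ) := mul_le_mul_of_nonneg_left (by exact_mod_cast hhM) hy0.le
    have hTnn : q * T ≤ T := by
      have : 0 ≤ T := by rw [← hT]; exact Finset.sum_nonneg fun k _ => mul_nonneg (Nat.cast_nonneg k) (hμ0 k)
      nlinarith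
    rw [hT]; linarith
  obtain ⟨lam, g, lo, hi, h0, h1, hg, hlohi, hhi, hμ, hgen⟩ :=
    exists_twoPoint_decomposition_TA M M le_rfl μ hμ0 hμM hμ1 y htop'
  refine ad3Decomp_of_pairPlan y q T M μ lam g lo hi hy0 hy1 hq0 hq1 hyq hta h0 h1 hμ fun r hr => ?_
  obtain ⟨hclo, hchi, hmean, hstrict, -⟩ := hgen r hr
  rw [hT] at hmean hstrict
  refine ⟨hlohi r, hhi r, (hg r).1, (hg r).2, hmean, ?_⟩
  rcases Nat.eq_or_lt_of_le (hlohi r) with he | hlt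
  · exact Or.inr (Or.inl he)
  · by_cases hself : q * T ≤ 2 * (lo r : ℝ)
    · exact Or.inr (Or.inr hself)
    · -- a genuine low: its pair is heavy because `hi r ≤ top`
      refine Or.inl ?_
      have hlow := hheavy (lo r) hclo (hstrict hlt).1 (not_le.1 hself)
      have hhitop : (hi r : ℝ) ≤ top := by exact_mod_cast htop (hi r) hchi
      have hd : (0 : ℝ) < (hi r : ℝ) - lo r := by
        have : (lo r : ℝ) < hi r := by exact_mod_cast hlt
        linarith
      -- `q g (hi − lo) = q (T − lo) ≥ y (top − lo) ≥ y (hi − lo)`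
      have e : q * (T - lo r) = q * g r * ((hi r : ℝ) - lo r) := by rw [← hmean]; ring
      have h2 : y * ((hi r : ℝ) - lo r) ≤ q * g r * ((hi r : ℝ) - lo r) := by nlinarith
      exact le_of_mul_le_mul_right h2 hd

/-- **`AD3ProdCell` WHEN THE PRODUCT'S LOWS PAIR HEAVILY WITH ITS TOP** (e.g. H⊗L2 with `y(hi₁+hi₂ − a) ≤ q(T − a)` for the largest low
`a`: EXACT CENSUS arm-3 g121 `explore/hl2_structure.py` — 20 912 of the 22 760 sampled H⊗L2 instances that HAVE a low; the remaining ones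
need pair transport into lower heavy partners (59) or a triple component (1 789)). [this work] -/
theorem ad3ProdCell_of_lows_heavyTop (y q T₁ T₂ : ℝ) (M₁ M₂ top : ℕ) (ω₁ ω₂ : ℕ → ℝ)
    (hy0 : 0 < y) (hyq : y < q) (hq1 : q ≤ 1) (hta₁ : y * (M₁ : ℝ) ≤ q * T₁) (hta₂ : y * (M₂ : ℝ) ≤ q * T₂)
    (h₁ : IsAD3Component y q T₁ M₁ ω₁) (h₂ : IsAD3Component y q T₂ M₂ ω₂)
    (htop : ∀ h, 0 < lconv M₁ M₂ ω₁ ω₂ h → h ≤ top)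
    (hheavy : ∀ a, 0 < lconv M₁ M₂ ω₁ ω₂ a → (a : ℝ) < T₁ + T₂ → 2 * (a : ℝ) < q * (T₁ + T₂) →
      y * ((top : ℝ) - a) ≤ q * (T₁ + T₂ - a)) :
    AD3Decomp y q (T₁ + T₂) (M₁ + M₂) (lconv M₁ M₂ ω₁ ω₂) := by
  obtain ⟨a0, aM, a1, amean⟩ := isAD3Component_laws h₁
  obtain ⟨b0, bM, b1, bmean⟩ := isAD3Component_laws h₂
  have hq0 : 0 < q := hy0.trans hyq
  have hy1 : y < 1 := lt_of_lt_of_le hyq hq1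
  refine ad3Decomp_of_lows_heavyTop y q (T₁ + T₂) (M₁ + M₂) top _ hy0 hy1 hq0 hq1 hyq.le (lconv_nonneg M₁ M₂ ω₁ ω₂ a0 b0)
    (fun k hk => lconv_eq_zero M₁ M₂ ω₁ ω₂ k hk) (sum_lconv M₁ M₂ ω₁ ω₂ a1 b1) ?_ ?_ htop hheavy
  · rw [sum_mul_lconv M₁ M₂ ω₁ ω₂ a1 b1, amean, bmean]
  · push_cast; rw [mul_add, mul_add]; exact add_le_add hta₁ hta₂

/-! ### The kind pair H⊗L2 of `AD3ProdCell`, down to its residual -/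

/-- charged atoms of a two-point law are its two ends. [folklore] -/
theorem tp_atom_cases (lo hi : ℕ) (γ : ℝ) (h : ℕ) (hpos : 0 < TP[lo, hi, γ, h]) : h = lo ∨ h = hi := by
  by_contra hc
  push Not at hc
  rw [if_neg hc.2, if_neg hc.1] at hpos
  simp at hpos

/-- **`AD3ProdCell` ON H⊗L2 ⟸ ITS RESIDUAL.**  Heavy pair `ω₁ = {lo₁, hi₁; γ₁}` (`y ≤ qγ₁`), admissible light pair `ω₂ = {lo₂, hi₂; γ₂}`
(`qγ₂ < y`, gated version DEC below `M₂`), both top-affordable, `0 < y < q ≤ 1`.  The product is AD3⁺ at `(y, q, T₁+T₂, M₁+M₂)` provided the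
RESIDUAL sub-cell is: a genuine low is present (`2(lo₁+lo₂) < q(T₁+T₂)`) AND the largest low does not pair heavily with the top `hi₁+hi₂`
(`q(T − a) < y(hi₁+hi₂ − a)` for `a = lo₁+lo₂`, or for `a = lo₁+hi₂` when that atom is a low too).  Everything else is `ad3ProdCell_of_minAtoms`
(no low) or `ad3ProdCell_of_lows_heavyTop`.  EXACT CENSUS (arm-3 g121): the residual is 1 848 of 22 760 low-carrying H⊗L2 instances
(59 pair-transport + 1 789 triple), ≈ 1.6 % of all sampled instances; 0 non-AD3⁺. [this work] -/
theorem ad3ProdCell_HL2_of_residual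
    (hR : ∀ (y q γ₁ γ₂ : ℝ) (M₁ M₂ lo₁ hi₁ lo₂ hi₂ : ℕ),
      0 < y → y < q → q ≤ 1 →
      lo₁ ≤ hi₁ → hi₁ ≤ M₁ → 0 ≤ γ₁ → γ₁ ≤ 1 → y ≤ q * γ₁ →
      y * (M₁ : ℝ) ≤ q * ((lo₁ : ℝ) + ((hi₁ : ℝ) - lo₁) * γ₁) →
      lo₂ < hi₂ → hi₂ ≤ M₂ → 0 ≤ γ₂ → γ₂ ≤ 1 → q * γ₂ < y →
      y * (M₂ : ℝ) ≤ q * ((lo₂ : ℝ) + ((hi₂ : ℝ) - lo₂) * γ₂) →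
      (∀ j', j' < M₂ → DECAt y j' M₂ (gate (fun h => TP[lo₂, hi₂, γ₂, h]) q)) →
      2 * ((lo₁ : ℝ) + lo₂) < q * (((lo₁ : ℝ) + ((hi₁ : ℝ) - lo₁) * γ₁) + ((lo₂ : ℝ) + ((hi₂ : ℝ) - lo₂) * γ₂)) →
      (q * ((((lo₁ : ℝ) + ((hi₁ : ℝ) - lo₁) * γ₁) + ((lo₂ : ℝ) + ((hi₂ : ℝ) - lo₂) * γ₂)) - ((lo₁ : ℝ) + lo₂))
          < y * (((hi₁ : ℝ) + hi₂) - ((lo₁ : ℝ) + lo₂)) ∨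
        (2 * ((lo₁ : ℝ) + hi₂) < q * (((lo₁ : ℝ) + ((hi₁ : ℝ) - lo₁) * γ₁) + ((lo₂ : ℝ) + ((hi₂ : ℝ) - lo₂) * γ₂)) ∧
          q * ((((lo₁ : ℝ) + ((hi₁ : ℝ) - lo₁) * γ₁) + ((lo₂ : ℝ) + ((hi₂ : ℝ) - lo₂) * γ₂)) - ((lo₁ : ℝ) + hi₂))
            < y * (((hi₁ : ℝ) + hi₂) - ((lo₁ : ℝ) + hi₂)))) →
      AD3Decomp y q (((lo₁ : ℝ) + ((hi₁ : ℝ) - lo₁) * γ₁) + ((lo₂ : ℝ) + ((hi₂ : ℝ) - lo₂) * γ₂)) (M₁ + M₂)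
        (lconv M₁ M₂ (fun h => TP[lo₁, hi₁, γ₁, h]) (fun h => TP[lo₂, hi₂, γ₂, h])))
    (y q γ₁ γ₂ : ℝ) (M₁ M₂ lo₁ hi₁ lo₂ hi₂ : ℕ)
    (hy0 : 0 < y) (hyq : y < q) (hq1 : q ≤ 1)
    (hlohi₁ : lo₁ ≤ hi₁) (hhi₁ : hi₁ ≤ M₁) (hγ₁0 : 0 ≤ γ₁) (hγ₁1 : γ₁ ≤ 1) (hheavy₁ : y ≤ q * γ₁)
    (hta₁ : y * (M₁ : ℝ) ≤ q * ((lo₁ : ℝ) + ((hi₁ : ℝ) - lo₁) * γ₁))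
    (hlohi₂ : lo₂ < hi₂) (hhi₂ : hi₂ ≤ M₂) (hγ₂0 : 0 ≤ γ₂) (hγ₂1 : γ₂ ≤ 1) (hlight₂ : q * γ₂ < y)
    (hta₂ : y * (M₂ : ℝ) ≤ q * ((lo₂ : ℝ) + ((hi₂ : ℝ) - lo₂) * γ₂))
    (hD₂ : ∀ j', j' < M₂ → DECAt y j' M₂ (gate (fun h => TP[lo₂, hi₂, γ₂, h]) q)) :
    AD3Decomp y q (((lo₁ : ℝ) + ((hi₁ : ℝ) - lo₁) * γ₁) + ((lo₂ : ℝ) + ((hi₂ : ℝ) - lo₂) * γ₂)) (M₁ + M₂)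
      (lconv M₁ M₂ (fun h => TP[lo₁, hi₁, γ₁, h]) (fun h => TP[lo₂, hi₂, γ₂, h])) := by
  have hq0 : 0 < q := hy0.trans hyq
  have hy1 : y < 1 := lt_of_lt_of_le hyq hq1
  -- the two factors as AD3⁺ components
  have h2lo₂ := lightPair_two_lo_ge y q γ₂ M₂ lo₂ hi₂ hy1.le hlohi₂ hhi₂ hγ₂0 hγ₂1 hlight₂ hD₂
  have h₁ : IsAD3Component y q ((lo₁ : ℝ) + ((hi₁ : ℝ) - lo₁) * γ₁) M₁ (fun h => TP[lo₁, hi₁, γ₁, h]) :=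
    Or.inl ⟨lo₁, hi₁, γ₁, hlohi₁, hhi₁, hγ₁0, hγ₁1, hheavy₁, rfl, rfl⟩
  have h₂ : IsAD3Component y q ((lo₂ : ℝ) + ((hi₂ : ℝ) - lo₂) * γ₂) M₂ (fun h => TP[lo₂, hi₂, γ₂, h]) :=
    Or.inr (Or.inl ⟨lo₂, hi₂, γ₂, hlohi₂, hhi₂, hγ₂0, hγ₂1, hlight₂, rfl, hD₂, rfl⟩)
  set T : ℝ := ((lo₁ : ℝ) + ((hi₁ : ℝ) - lo₁) * γ₁) + ((lo₂ : ℝ) + ((hi₂ : ℝ) - lo₂) * γ₂) with hT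
  -- no low at all
  by_cases hlow : 2 * ((lo₁ : ℝ) + lo₂) < q * T
  swap
  · exact ad3ProdCell_of_minAtoms y q _ _ M₁ M₂ lo₁ lo₂ _ _ hy0 hyq hq1 hta₁ hta₂ h₁ h₂
      (fun i hi => by rcases tp_atom_cases lo₁ hi₁ γ₁ i hi with h | h <;> omega)
      (fun k hk => by rcases tp_atom_cases lo₂ hi₂ γ₂ k hk with h | h <;> omega) (not_lt.1 hlow)
  -- the lows pair heavily with the top, or the residual
  by_cases hA1 : q * (T - ((lo₁ : ℝ) + lo₂)) < y * (((hi₁ : ℝ) + hi₂) - ((lo₁ : ℝ) + lo₂))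
  · exact hR y q γ₁ γ₂ M₁ M₂ lo₁ hi₁ lo₂ hi₂ hy0 hyq hq1 hlohi₁ hhi₁ hγ₁0 hγ₁1 hheavy₁ hta₁ hlohi₂ hhi₂ hγ₂0 hγ₂1 hlight₂ hta₂ hD₂
      hlow (Or.inl hA1)
  by_cases hA2 : 2 * ((lo₁ : ℝ) + hi₂) < q * T ∧ q * (T - ((lo₁ : ℝ) + hi₂)) < y * (((hi₁ : ℝ) + hi₂) - ((lo₁ : ℝ) + hi₂))
  · exact hR y q γ₁ γ₂ M₁ M₂ lo₁ hi₁ lo₂ hi₂ hy0 hyq hq1 hlohi₁ hhi₁ hγ₁0 hγ₁1 hheavy₁ hta₁ hlohi₂ hhi₂ hγ₂0 hγ₂1 hlight₂ hta₂ hD₂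
      hlow (Or.inr hA2)
  -- heavy-top case
  have hT₁le : (lo₁ : ℝ) + ((hi₁ : ℝ) - lo₁) * γ₁ ≤ hi₁ := by
    have : (lo₁ : ℝ) ≤ hi₁ := by exact_mod_cast hlohi₁
    nlinarith
  refine ad3ProdCell_of_lows_heavyTop y q _ _ M₁ M₂ (hi₁ + hi₂) _ _ hy0 hyq hq1 hta₁ hta₂ h₁ h₂ ?_ ?_
  · intro h hh
    obtain ⟨i, k, hik, hi, hk⟩ := exists_of_lconv_pos M₁ M₂ _ _ (tp_laws M₁ lo₁ hi₁ γ₁ hγ₁0 hγ₁1 hlohi₁ hhi₁).1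
      (tp_laws M₂ lo₂ hi₂ γ₂ hγ₂0 hγ₂1 hlohi₂.le hhi₂).1 h hh
    rcases tp_atom_cases lo₁ hi₁ γ₁ i hi with e₁ | e₁ <;> rcases tp_atom_cases lo₂ hi₂ γ₂ k hk with e₂ | e₂ <;> omega
  · intro a ha _ h2a
    obtain ⟨i, k, hik, hi, hk⟩ := exists_of_lconv_pos M₁ M₂ _ _ (tp_laws M₁ lo₁ hi₁ γ₁ hγ₁0 hγ₁1 hlohi₁ hhi₁).1
      (tp_laws M₂ lo₂ hi₂ γ₂ hγ₂0 hγ₂1 hlohi₂.le hhi₂).1 a ha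
    push_cast
    rcases tp_atom_cases lo₁ hi₁ γ₁ i hi with e₁ | e₁ <;> rcases tp_atom_cases lo₂ hi₂ γ₂ k hk with e₂ | e₂
    · -- a = lo₁ + lo₂
      have ea : (a : ℝ) = (lo₁ : ℝ) + lo₂ := by rw [← hik, e₁, e₂]; push_cast; ring
      rw [ea]; exact not_lt.1 hA1
    · -- a = lo₁ + hi₂
      have ea : (a : ℝ) = (lo₁ : ℝ) + hi₂ := by rw [← hik, e₁, e₂]; push_cast; ring
      rw [ea] at h2a ⊢
      by_contra hc
      exact hA2 ⟨h2a, not_le.1 hc⟩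
    · -- a = hi₁ + lo₂ is never a low: 2hi₁ ≥ qT₁ and 2lo₂ ≥ qT₂
      exfalso
      have ea : (a : ℝ) = (hi₁ : ℝ) + lo₂ := by rw [← hik, e₁, e₂]; push_cast; ring
      rw [ea] at h2a
      have : q * ((lo₁ : ℝ) + ((hi₁ : ℝ) - lo₁) * γ₁) ≤ 2 * (hi₁ : ℝ) := by nlinarith
      linarith
    · -- a = hi₁ + hi₂ likewise
      exfalso
      have ea : (a : ℝ) = (hi₁ : ℝ) + hi₂ := by rw [← hik, e₁, e₂]; push_cast; ring
      rw [ea] at h2a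
      have hlh : (lo₂ : ℝ) ≤ hi₂ := by exact_mod_cast hlohi₂.le
      have : q * ((lo₁ : ℝ) + ((hi₁ : ℝ) - lo₁) * γ₁) ≤ 2 * (hi₁ : ℝ) := by nlinarith
      linarith

end LawDec

end Quant

end Summit.CriticalPhenomena.PercolationContinuityZ3.Theorems
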